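import Literature.MathematicalPhysics.QuantumFieldTheory.Balaban1983to89.HiggsCovariancePos
import Literature.MathematicalPhysics.QuantumFieldTheory.Balaban1983to89.HiggsAveragingCompose
import Literature.MathematicalPhysics.QuantumFieldTheory.Balaban1983to89.B1Eq214Concrete

/-!
# `Balaban1983to89.B1Eq27StepAdjoint` — T. Bałaban, *(Higgs)₂,₃ quantum fields in a finite volume. I. A lower bound*,
Commun. Math. Phys. **85** (1982) 603–626 [Balaban1982Higgs1]: the ONE-STEP averaging operator `Q(A)` of (2.7) at every
level `j` of the tower `T^{(j)}_{L^jε}` as a linear map, its (1.5)-adjoint `Q^*(A)` (*"The adjoint operators with respect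
to the scalar product (1.5) can be easily written up"*, p. 604), and the structural identities the renormalization group
equations (2.41)–(2.43) rest on — `Q(A)Q^*(A) = 1`, `Q_{k+1}(A) = Q(A)Q_k(A)`, `Q^*_{k+1}(A) = Q^*_k(A)Q^*(A)`,
`Q_k(A)Q^*_k(A) = 1` — PROVED for the CONCRETE model of `…HiggsLattice` / `…HiggsAveraging` / `…HiggsCovariance`
(arbitrary external vector field `A`, arbitrary coupling `U(A) = exp(qεeA)`)

statement-level skeleton of published theorems with citation tags; proofs where landed; nothing here is a claim about the Yang–Mills mass gap

PDF held: `paper:balaban1982-cmp85-higgs23-i` (journal page = PDF page + 602); pp. 604, 608, 609, 610, 612 [PDF 2, 6,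
7, 8, 10] read AS IMAGES from the ×2 renders `run/shared/lean/pub/pub-balaban/b2b-balaban-ref1/pages/1982-cmp85-higgs23-I/
1982-cmp85-higgs23-I-p006-x2.png`, `…-p007-x2.png`, `…-p008-x2.png`, `…-p010-x2.png` (cell `pub-balaban`).

CITATION HEADER (lean-in-tree rule) — WHAT IS REPRODUCED.  Cell `lit-balaban` (HOME `run/shared/lean/pub/lit-balaban/`),
Phase-2 proof seat p35 (gen 3), FILE 1 of 2 of the line «B1 (2.41)/(2.42)/(2.43) = B4 (2.34) for the concrete
gauge-covariant operators» (file 2: `B1Eq243HiggsModel`).  SKELETON rows served (no row's decl of record is restated;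
owners r01/r14): **B1.Eq2.7** ((2.7): the one-step `Q(A)` — here packaged as a LINEAR MAP at every level, `avgQLin`,
definitionally the typer's function `HiggsAveraging.avgQ`, `avgQLin_apply`), **B1.Eq2.12** ((2.12)–(2.14), operator
content `Q_{k+1}(A) = Q(A)Q_k(A)`: r14's `HiggsAveragingCompose.avgQ_avgQk` re-read for the linear maps of record
`HiggsCovariance.avgQkLin`, plus ITS ADJOINT FORM `Q^*_{k+1}(A) = Q^*_k(A)Q^*(A)` for `HiggsCovariance.avgQkAdj`, new
here), **B1.Eq2.20** (`P_k(A) = Q^*_k(A)Q_k(A)` IS a projection: `Q_k(A)Q^*_k(A) = 1`, new here), and the hypotheses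
`QQ^* = 1` / adjointness of the tree's ABSTRACT renormalization-group module `B1RG242` (`Tower.Consistent.QQs`,
`StepData.ScalarProducts.adj`) for the concrete one-step operators.
PRINT, verbatim.  p. 604 [PDF 2]: *"The adjoint operators with respect to the scalar product ⟨f,g⟩ = Σ_{x∈T_ε} ε^d f(x)·g(x)
(1.5) can be easily written up."*  p. 608 [PDF 6]: *"(Q(A)φ)(y) = L^{−d} Σ_{x∈B(y)} U(A(Γ_{y,x}))φ(x). (2.7)"*; (2.2):
*"Let us denote by x_j a point of torus T^{(j)}_{L^jε}, such that x ∈ B^j(x_j). Of course x_k = y and x_j ∈ B(x_{j+1}). We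
define Γ^{(k)}_{y,x} = Γ_{y,x_{k−1}} ∪ Γ_{x_{k−1},x_{k−2}} ∪ … ∪ Γ_{x_1,x}"*.  p. 609 [PDF 7]: *"Although formally the same
for all k, the above definitions are in fact different because the contours Γ_{y,x} depend on the scale L^kε, as it was
noted above. Here the external vector field A defined on T_ε is arbitrary."*; *"(Q_k(A)f)(y) = L^{−kd} Σ_{x∈B^k(y)}
U(A(Γ^{(k)}_{y,x}))f(x), y ∈ T^{(k)}_{L^kε}. (2.11)"*; *"From this formula we obtain T^{L^kε}_{a,L,A}T^ε_{a_k,L^k,A} =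
T^ε_{a_{k+1},L^{k+1},A}. (2.14)"*.  p. 610 [PDF 8]: *"P_k(A) = Q^*_k(A)Q_k(A), (2.20)"*.  p. 605 [PDF 3]: *"Antisymmetry
of q implies U(A)^* = U(−A) = U(−A)^{−1}"*.

WHAT THIS FILE PROVES (0 sorry; axioms ⊆ {propext, Classical.choice, Quot.sound}; definitions with bodies).
§1 `avgQLin C A j` = (2.7) at level `j` as a linear map (`avgQLin_apply`: IS `HiggsAveraging.avgQ`); `avgQAdjLin C A j` =
   its adjoint `(Q^*(A)ψ)(x) = U(A(Γ_{x_1,x}))^* ψ(x_1)`, `x_1` the block point of `x` (`avgQAdjLin_apply`).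
§2 `siteInner_avgQLin` : `⟨Q(A)φ, ψ⟩_{T^{(j+1)}} = ⟨φ, Q^*(A)ψ⟩_{T^{(j)}}` for the scalar products (1.5) (weights `(L^{j+1}ε)^d`
   and `(L^jε)^d`; the factor `L^{−d}` of (2.7) absorbs the ratio) — `Q^*(A)` IS the adjoint, every level `j`.
§3 `avgQLin_comp_avgQAdjLin` : `Q(A)Q^*(A) = 1` at the levels `j < K` of the paper (the block `B(y)` has `L^d` points,
   `B1Eq214Concrete.sum_block_eq_sum_blockSite`; `U U^* = 1` by unitarity, p. 605).
§4 the tower: `avgQLin_comp_avgQkLin` : `Q_{k+1}(A) = Q(A) ∘ Q_k(A)` (r14's `avgQ_avgQk` on the linear maps of record);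
   `avgQkAdj_succ` : `Q^*_{k+1}(A) = Q^*_k(A) ∘ Q^*(A)` (the transports multiply along the concatenation (2.2),
   `HiggsAveragingCompose.U_contourSum_mul_U_multiContourSum`, and `(UV)^* = V^*U^*`); `avgQkLin_one`/`avgQkAdj_one`
   (`Q_1 = Q`, `Q^*_1 = Q^*` at level 0: r14's `B1Eq214Concrete.avgQk_one`); `avgQkLin_comp_avgQkAdj` :
   `Q_k(A)Q^*_k(A) = 1` for `k ≤ K` (induction), whence `projPk_comp_projPk` : `P_k(A)² = P_k(A)` — the projection of (2.20).
HONEST SCOPE.  Pure finite-dimensional algebra on the concrete carriers; nothing quantitative; the levels `j < K`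
(resp. `k ≤ K`) are exactly the paper's (the carrier `HiggsLattice.Site P j` is meaningful for `j ≤ K`).  Value =
kernel certificates making the hypotheses of `B1RG242` theorems for Bałaban's concrete covariant operators; NOT summit
progress.  Unit `lit-balaban-p35` gen 3, HOME `run/shared/lean/pub/lit-balaban/`.
-/

open scoped BigOperators InnerProductSpace

namespace Literature.MathematicalPhysics.QuantumFieldTheory.Balaban1983to89.B1Eq27StepAdjoint

open HiggsLattice HiggsAveraging HiggsAveragingCompose HiggsCovariance HiggsCovariancePos

variable {P : HiggsLattice.Params} {N : ℕ}

/-! ## §1 The one-step operators `Q(A)`, `Q^*(A)` at level `j` as linear maps -/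

/-- **(2.7)** p. 608 at level `j` as a LINEAR MAP `(T^{(j)} → ℝ^N) → (T^{(j+1)} → ℝ^N)`:
`(Q(A)φ)(y) = L^{−d} Σ_{x ∈ B(y)} U(A(Γ_{y,x}))φ(x)` (the typer's function `HiggsAveraging.avgQ` packaged with its
linearity, exactly as `HiggsCovariance.avgQkLin` packages (2.11)). [cite: Balaban1982Higgs1, (2.7) p.608] -/
noncomputable def avgQLin (C : ChargeData N) (A : HiggsLattice.VecField P 0) (j : ℕ) :
    ScalarField P j N →ₗ[ℝ] ScalarField P (j + 1) N :=
  LinearMap.pi fun y => (((P.L : ℝ) ^ P.d)⁻¹) •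
    ∑ x ∈ HiggsLattice.block y,
      (C.U (P.mesh 0) (contourSum A (toFinest y) (toFinest x))).toLinearMap
        ∘ₗ (LinearMap.proj x : ScalarField P j N →ₗ[ℝ] E N)

/-- `avgQLin` IS the function `HiggsAveraging.avgQ` of (2.7). [cite: Balaban1982Higgs1, (2.7) p.608] -/
theorem avgQLin_apply (C : ChargeData N) (A : HiggsLattice.VecField P 0) (j : ℕ) (φ : ScalarField P j N) (y : HiggsLattice.Site P (j + 1)) :
    avgQLin C A j φ y = avgQ C A φ y := by
  simp [avgQLin, avgQ_apply, LinearMap.sum_apply]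

/-- `avgQLin` and `avgQ` agree as functions. [cite: Balaban1982Higgs1, (2.7) p.608] -/
theorem avgQLin_coe (C : ChargeData N) (A : HiggsLattice.VecField P 0) (j : ℕ) (φ : ScalarField P j N) :
    (avgQLin C A j φ : ScalarField P (j + 1) N) = avgQ C A φ :=
  funext fun y => avgQLin_apply C A j φ y

/-- **The adjoint `Q^*(A)` of (2.7)** at level `j` for the scalar products (1.5) (p. 604: *"can be easily written up"*):
`(Q^*(A)ψ)(x) = U(A(Γ_{x_1,x}))^* ψ(x_1)`, `x_1 ∈ T^{(j+1)}` the HiggsLattice.block point of `x ∈ T^{(j)}` (`x ∈ B(x_1)`, p. 608),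
`U^* = U(−A)` (p. 605); the weights `(L^{j+1}ε)^d · L^{−d} = (L^jε)^d` combine to `1` (`siteInner_avgQLin`).
[cite: Balaban1982Higgs1, (1.5) p.604] -/
noncomputable def avgQAdjLin (C : ChargeData N) (A : HiggsLattice.VecField P 0) (j : ℕ) :
    ScalarField P (j + 1) N →ₗ[ℝ] ScalarField P j N :=
  LinearMap.pi fun x =>
    (star (C.U (P.mesh 0) (contourSum A (toFinest (HiggsLattice.blockOf x)) (toFinest x)))).toLinearMap
      ∘ₗ (LinearMap.proj (HiggsLattice.blockOf x) : ScalarField P (j + 1) N →ₗ[ℝ] E N)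

/-- Pointwise formula of `Q^*(A)`. [cite: Balaban1982Higgs1, (1.5) p.604] -/
theorem avgQAdjLin_apply (C : ChargeData N) (A : HiggsLattice.VecField P 0) (j : ℕ) (ψ : ScalarField P (j + 1) N) (x : HiggsLattice.Site P j) :
    avgQAdjLin C A j ψ x = star (C.U (P.mesh 0) (contourSum A (toFinest (HiggsLattice.blockOf x)) (toFinest x))) (ψ (HiggsLattice.blockOf x)) := by
  simp [avgQAdjLin]

/-! ## §2 `Q^*(A)` IS the adjoint of `Q(A)` for the scalar products (1.5) -/

/-- The weights of (1.5) on consecutive lattices versus the normalisation `L^{−d}` of (2.7):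
`(L^{j+1}ε)^d · L^{−d} = (L^jε)^d`. [cite: Balaban1982Higgs1, (1.5) p.604] -/
theorem mesh_succ_pow_mul (j : ℕ) : P.mesh (j + 1) ^ P.d * ((P.L : ℝ) ^ P.d)⁻¹ = P.mesh j ^ P.d := by
  have hL : (0 : ℝ) < (P.L : ℝ) ^ P.d := pow_pos (by exact_mod_cast P.hL) _
  unfold HiggsLattice.Params.mesh
  rw [pow_succ, mul_pow, mul_pow, mul_pow]
  field_simp

/-- **`⟨Q(A)φ, ψ⟩_{T^{(j+1)}} = ⟨φ, Q^*(A)ψ⟩_{T^{(j)}}`** for the scalar products (1.5) (weights `(L^{j+1}ε)^d`, `(L^jε)^d`):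
`avgQAdjLin` IS the adjoint announced on p. 604.  PROVED (fibrewise summation over the blocks `B(y)`, unitarity
`⟨u, U^*v⟩ = ⟨Uu, v⟩`). [cite: Balaban1982Higgs1, (1.5) p.604] -/
theorem siteInner_avgQLin (C : ChargeData N) (A : HiggsLattice.VecField P 0) (j : ℕ) (φ : ScalarField P j N)
    (ψ : ScalarField P (j + 1) N) :
    siteInner (avgQLin C A j φ) ψ = siteInner φ (avgQAdjLin C A j ψ) := by
  unfold siteInner
  simp_rw [avgQLin_apply, avgQ_apply, real_inner_smul_left, sum_inner, avgQAdjLin_apply, inner_star_U]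
  have hfib : ∑ y : HiggsLattice.Site P (j + 1), ∑ x ∈ HiggsLattice.block y,
        P.mesh j ^ P.d * ⟪C.U (P.mesh 0) (contourSum A (toFinest (HiggsLattice.blockOf x)) (toFinest x)) (φ x), ψ (HiggsLattice.blockOf x)⟫_ℝ
      = ∑ x : HiggsLattice.Site P j,
        P.mesh j ^ P.d * ⟪C.U (P.mesh 0) (contourSum A (toFinest (HiggsLattice.blockOf x)) (toFinest x)) (φ x), ψ (HiggsLattice.blockOf x)⟫_ℝ := by
    unfold HiggsLattice.block
    exact Finset.sum_fiberwise Finset.univ HiggsLattice.blockOf _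
  rw [← hfib]
  refine Finset.sum_congr rfl fun y _ => ?_
  rw [← mul_assoc, mesh_succ_pow_mul, Finset.mul_sum]
  refine Finset.sum_congr rfl fun x hx => ?_
  have hxy : HiggsLattice.blockOf x = y := by simpa [HiggsLattice.block] using hx
  rw [hxy]

/-! ## §3 `Q(A)Q^*(A) = 1` (the blocks have `L^d` points; `UU^* = 1`) -/

/-- `U(a) U(a)^* v = v` (p. 605: `U` unitary). [cite: Balaban1982Higgs1, (1.7) p.605] -/
theorem U_star_U_apply (C : ChargeData N) (η a : ℝ) (v : E N) : C.U η a (star (C.U η a) v) = v := by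
  have h := Unitary.mul_star_self_of_mem (C.U_mem_unitary η a)
  have h' := congrArg (fun T : E N →L[ℝ] E N => T v) h
  simpa using h'

/-- `U(a)^* U(a) v = v`. [cite: Balaban1982Higgs1, (1.7) p.605] -/
theorem star_U_U_apply (C : ChargeData N) (η a : ℝ) (v : E N) : star (C.U η a) (C.U η a v) = v := by
  have h := Unitary.star_mul_self_of_mem (C.U_mem_unitary η a)
  have h' := congrArg (fun T : E N →L[ℝ] E N => T v) h
  simpa using h'

/-- `|B(y)| = L^d` in the form used here: a constant summed over a HiggsLattice.block of the levels `j < K`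
(`B1Eq214Concrete.sum_block_eq_sum_blockSite`). [cite: Balaban1982Higgs1, (1.17) p.606] -/
theorem sum_block_const {j : ℕ} (hj : j < P.K) (y : HiggsLattice.Site P (j + 1)) (v : E N) :
    ∑ _x ∈ HiggsLattice.block y, v = ((P.L : ℝ) ^ P.d) • v := by
  rw [B1Eq214Concrete.sum_block_eq_sum_blockSite hj y (fun _ => v), Finset.sum_const, Finset.card_univ,
    Fintype.card_fun, Fintype.card_fin, Fintype.card_fin, ← Nat.cast_smul_eq_nsmul ℝ]
  push_cast
  ring_nf

/-- **`Q(A)Q^*(A) = 1`** at the levels `j < K`: averaging the covariantly HiggsLattice.block-constant extension returns the coarse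
field (the hypothesis `QQ^* = 1` of `B1RG242.Tower.Consistent`, B4 p. 580 *"P_k is an orthogonal projection"*, for the
concrete one-step operators). PROVED. [cite: Balaban1982Higgs1, (2.7) p.608] -/
theorem avgQLin_avgQAdjLin {j : ℕ} (hj : j < P.K) (C : ChargeData N) (A : HiggsLattice.VecField P 0) (ψ : ScalarField P (j + 1) N) :
    avgQLin C A j (avgQAdjLin C A j ψ) = ψ := by
  have hL : ((P.L : ℝ) ^ P.d) ≠ 0 := pow_ne_zero _ (by exact_mod_cast P.hL.ne')
  funext y
  rw [avgQLin_apply, avgQ_apply]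
  have hsum : ∑ x ∈ HiggsLattice.block y, C.U (P.mesh 0) (contourSum A (toFinest y) (toFinest x)) (avgQAdjLin C A j ψ x)
      = ∑ _x ∈ HiggsLattice.block y, ψ y := by
    refine Finset.sum_congr rfl fun x hx => ?_
    have hxy : HiggsLattice.blockOf x = y := by simpa [HiggsLattice.block] using hx
    rw [avgQAdjLin_apply, hxy, U_star_U_apply]
  rw [hsum, sum_block_const hj, smul_smul, inv_mul_cancel₀ hL, one_smul]

/-- The same as an identity of linear maps: `Q(A) ∘ Q^*(A) = id` (`j < K`). [cite: Balaban1982Higgs1, (2.7) p.608] -/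
theorem avgQLin_comp_avgQAdjLin {j : ℕ} (hj : j < P.K) (C : ChargeData N) (A : HiggsLattice.VecField P 0) :
    avgQLin C A j ∘ₗ avgQAdjLin C A j = LinearMap.id :=
  LinearMap.ext fun ψ => avgQLin_avgQAdjLin hj C A ψ

/-! ## §4 The tower: `Q_{k+1} = QQ_k`, `Q^*_{k+1} = Q^*_kQ^*`, `Q_1 = Q`, `Q_kQ^*_k = 1` -/

/-- **`Q_{k+1}(A) = Q(A) ∘ Q_k(A)`** as linear maps (operator content of (2.2)/(2.12)/(2.14); r14's
`HiggsAveragingCompose.avgQ_avgQk` read on `HiggsCovariance.avgQkLin`). [cite: Balaban1982Higgs1, (2.14) p.609] -/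
theorem avgQLin_comp_avgQkLin (C : ChargeData N) (A : HiggsLattice.VecField P 0) (k : ℕ) :
    avgQLin C A k ∘ₗ avgQkLin C A k = avgQkLin C A (k + 1) := by
  refine LinearMap.ext fun f => funext fun z => ?_
  have hk : (avgQkLin C A k f : ScalarField P k N) = avgQk C A k f := funext fun y => avgQkLin_apply C A k f y
  rw [LinearMap.comp_apply, avgQLin_apply, avgQkLin_apply, hk, avgQ_avgQk]

/-- **`Q^*_{k+1}(A) = Q^*_k(A) ∘ Q^*(A)`**: the transports multiply along the concatenation (2.2),
`U(A(Γ_{x_{k+1},x_k}))U(A(Γ^{(k)}_{x_k,x})) = U(A(Γ^{(k+1)}_{x_{k+1},x}))`, and `(UV)^* = V^*U^*`. PROVED.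
[cite: Balaban1982Higgs1, (2.2) p.608] -/
theorem avgQkAdj_succ (C : ChargeData N) (A : HiggsLattice.VecField P 0) (k : ℕ) :
    avgQkAdj C A (k + 1) = avgQkAdj C A k ∘ₗ avgQAdjLin C A k := by
  refine LinearMap.ext fun ψ => funext fun x => ?_
  have hxz : x ∈ blockK (k + 1) (blockIter (k + 1) x) := (mem_blockK _ _ _).mpr rfl
  have hU := U_contourSum_mul_U_multiContourSum C A k (blockIter (k + 1) x) x hxz
  rw [LinearMap.comp_apply]
  simp only [avgQkAdj, LinearMap.pi_apply, LinearMap.coe_comp, Function.comp_apply, LinearMap.coe_proj,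
    Function.eval, ContinuousLinearMap.coe_coe, avgQAdjLin_apply]
  rw [← hU, star_mul, blockIter_succ]
  rfl

/-- `Q_1(A) = Q(A)` at level `0` as linear maps ((2.11) at `k = 1` is (2.7); r14's `B1Eq214Concrete.avgQk_one`).
[cite: Balaban1982Higgs1, (2.11) p.609] -/
theorem avgQkLin_one (C : ChargeData N) (A : HiggsLattice.VecField P 0) : avgQkLin C A 1 = avgQLin C A 0 := by
  refine LinearMap.ext fun f => funext fun y => ?_
  rw [avgQkLin_apply, avgQLin_apply, B1Eq214Concrete.avgQk_one]

/-- `Q^*_1(A) = Q^*(A)` at level `0` (`Γ^{(1)}_{y,x} = Γ_{y,x}`). [cite: Balaban1982Higgs1, (2.11) p.609] -/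
theorem avgQkAdj_one (C : ChargeData N) (A : HiggsLattice.VecField P 0) : avgQkAdj C A 1 = avgQAdjLin C A 0 := by
  refine LinearMap.ext fun ψ => funext fun x => ?_
  simp [avgQkAdj, avgQAdjLin_apply, multiContourSum, blockIter]

/-- **`Q_k(A)Q^*_k(A) = 1`** for `k ≤ K` (induction down the tower: `Q_{k+1}Q^*_{k+1} = Q(Q_kQ^*_k)Q^* = QQ^* = 1`;
at `k = 0` both operators are the identity up to `U(0) = 1`): `P_k(A) = Q^*_kQ_k` of (2.20) is a PROJECTION (B4 p. 580:
*"The operator P_k is an orthogonal projection"*). PROVED. [cite: Balaban1982Higgs1, (2.20) p.610] -/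
theorem avgQkLin_comp_avgQkAdj (C : ChargeData N) (A : HiggsLattice.VecField P 0) :
    ∀ {k : ℕ}, k ≤ P.K → avgQkLin C A k ∘ₗ avgQkAdj C A k = LinearMap.id
  | 0, _ => by
      refine LinearMap.ext fun ψ => funext fun x => ?_
      rw [LinearMap.comp_apply, LinearMap.id_apply, avgQkLin_apply, avgQk_apply]
      have hb : blockK 0 x = {x} := by ext x'; simp [mem_blockK, blockIter]
      simp [avgQkAdj, hb, multiContourSum_zero, ChargeData.U_zero, blockIter]
  | k + 1, hk => by
      have hk' : k < P.K := by omega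
      rw [← avgQLin_comp_avgQkLin, avgQkAdj_succ, LinearMap.comp_assoc,
        ← LinearMap.comp_assoc (avgQAdjLin C A k) (avgQkAdj C A k) (avgQkLin C A k),
        avgQkLin_comp_avgQkAdj C A hk'.le, LinearMap.id_comp, avgQLin_comp_avgQAdjLin hk']

/-- `P_k(A)P_k(A) = P_k(A)` for `k ≤ K`: the operator (2.20) is idempotent. [cite: Balaban1982Higgs1, (2.20) p.610] -/
theorem projPk_comp_projPk (C : ChargeData N) (A : HiggsLattice.VecField P 0) {k : ℕ} (hk : k ≤ P.K) :
    projPk C A k ∘ₗ projPk C A k = projPk C A k := by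
  unfold projPk
  rw [LinearMap.comp_assoc, ← LinearMap.comp_assoc (avgQkLin C A k) (avgQkAdj C A k) (avgQkLin C A k),
    avgQkLin_comp_avgQkAdj C A hk, LinearMap.id_comp]

/-- `⟨φ, Q^*(A)ψ⟩` form of the one-step adjointness with the arguments of (1.5) swapped (symmetry of (1.5)).
[cite: Balaban1982Higgs1, (1.5) p.604] -/
theorem siteInner_avgQAdjLin (C : ChargeData N) (A : HiggsLattice.VecField P 0) (j : ℕ) (ψ : ScalarField P (j + 1) N)
    (φ : ScalarField P j N) :
    siteInner (avgQAdjLin C A j ψ) φ = siteInner ψ (avgQLin C A j φ) := by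
  have hsymm : ∀ {i M : ℕ} (f g : ScalarField P i M), siteInner f g = siteInner g f := fun f g => by
    unfold siteInner
    exact Finset.sum_congr rfl fun x _ => by rw [real_inner_comm]
  rw [hsymm, ← siteInner_avgQLin, hsymm]

end Literature.MathematicalPhysics.QuantumFieldTheory.Balaban1983to89.B1Eq27StepAdjoint
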